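/-
Copyright (c) 2026 the pub-hodgecm-mathlib formalisation cell (harness21).  Prover seat hodgecm-mathlib-LH4-p06 (g5), Track A «(D-RAM) FOUR-FRAME», unit U2H, census leaf
(ρ2b′-X) `stub_U2H_fixedPointCensus_typeTwo_unit0` — SOCKET (C) `orderCountCensusC` (type RamM), hand (C-1) «u-FREE TABLES `hnP ∕ hnM` of ★ p857711» (LH4-p04 (g5) SOCKET (C)
LEAD LINES #1–#2), FILE (C-1 prep): the ROW ENGINES — shallow levels, the `k = −1` line, dead classes, and the anchored (non-norm) class.  2026-09-04.
-/
import Summits.HodgeConjecture.HodgeConjecture.Theorems.F0P3cDyRamToricLevelCensusRamMTopCellsPrep   -- ★ p858084 (this seat): `v_twist_norm_sub_one_le` ∕ `v_twist_thetaFixed_sub_one_le`; brings ★ Side (threshold), ★ T5c base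
import Literature.NumberTheory.LocalFields.QuadraticOrderLevelCountsRamifiedNoTranslator             -- ★ p857782 (LH4-p04 (g4)): the no-translator counts (`…_of_le`, `…_of_forall_not`)
import HarnessLib

/-!
# T5c (C-1 prep): ROW ENGINES for the u-free tables of the RamM census — `[U:H] = q^j` rows, empty rows, and the anchored class via the threshold

Cell `hodgecm-mathlib` (D-0151), FLOOR 0, crux H413 = `stmt-HodgeConjecture-24833`; squad F0∕P3c∕LH4; lane `--supports stmt-HodgeConjecture-24833 --as helper` (count-neutral).
THEOREMS ONLY (no `def`, no instance, no notation, no `sorry`, default heartbeats).  Socket served: LH4-p04 (g5)'s SOCKET (C) `orderCountCensusC`, brick (C-1): the u-free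
level tables `hnP ∕ hnM` of ★ p857711 `toricCensusSum_ramM` for `nP j a := #levelSet_h(j,a)`, `nM := #levelSet_{h′}`.  With `R = exp(2a − 2j − d_ρ)` the level radius
(K♮-level `k = j − a − s0`, `2d′ = d_ρ + 2s0`) and `η = (ρh∕h)·t(α^{k₀})` the cell's class (`v_h + d_ρ + 2k₀ + 2j = 2a`), THIS FILE turns ★ p857782's no-translator counts
(stated on the unfolded set) into `levelSet` rows with the subgroups built in:
* §1 `v_norm_sub_map_le_of_unit` (every unit has norm depth `≤ exp(−2d′)`), `theta_one_add_classMult_mul_twist` (the class values are `Θ`-fixed when `Θh = h`);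
* §2 class-agnostic rows under the SHALLOW letter `|1 + η| ≤ exp(−(2d′ − 2))` (every class of `T♮` lies within K♮-depth `d′ − 1` of `−1`; a (C-1cls) letter):
  **`ncard_levelSet_zero_eq_pow_of_shallow`** (`a = 0`, `k ≤ −1`: `q^j`), **`ncard_levelSet_pos_eq_zero_of_shallow`** (`a ≥ 1`, `k ≤ −2`: `0`),
  **`ncard_levelSet_pos_eq_pow_of_notMet`** (`a ≥ 1`, `k = −1`, class NOT met at K♮-depth `d′`: `q^j` — the odd-class line), and the dead rows
  **`ncard_levelSet_pos_eq_zero_of_notMet`** ∕ **`ncard_levelSet_zero_eq_zero_of_notMet`** (class not met at `R`: `0`);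
* §3 the ANCHORED class (`η·t(ω₀)·ψ(n₀) = −1`, `n₀` the `Θ`-fixed unit non-norm): **`met_iff_le_threshold_of_anchor`** — met at K♮-level `k` iff `k + 2 ≤ dΘ` (★ threshold).
The tables themselves (`…RamMTables`, `…RamMTablesAniso`) combine these with ★ T5c §4–§5 (translator class) and ★ p857465's indices.
HONEST LABEL.  Count-neutral (`--supports`); unconditional local algebra; nothing of (ρ2b′-X) is asserted — `HC_CM` is proved only modulo the 7 printed citations (2 remaining named
inputs: hLiu418 = `stmt-HodgeConjecture-24832`, h413 = `stmt-HodgeConjecture-24833`) until rung 0 closes.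

## References
* [Flicker1998UnitaryFL] Y. Z. Flicker, *Elementary proof of the fundamental lemma for a unitary group*, Canad. J. Math. 50 (1998): Prop. 7 p. 84; p. 84 Remark (Mars).
* [Serre1979] J.-P. Serre, *Local Fields*, GTM 67 (1979): Ch. IV §1 Prop. 3–4; Ch. V §3 Cor. 3.
* [Jacobowitz1962] R. Jacobowitz, *Hermitian forms over local fields*, Amer. J. Math. 84 (1962): §4.
-/

set_option autoImplicit false

noncomputable section

namespace Summit.HodgeConjecture.HodgeConjecture.Cruxes.H413.F0P3cDyRamToricLevelCensusRamM

open WithZero IsLocalRing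
open scoped Valued Pointwise
open Literature.NumberTheory.Automorphic.UnitaryThreeFourFrame (IsRamifiedQuadraticDatum)
open Literature.NumberTheory.LocalFields.QuadraticOrder Literature.NumberTheory.LocalFields.WildQuadraticDatum
open Summit.HodgeConjecture.HodgeConjecture.Cruxes.H413.F0P3cDyRamToricCensusDefs

variable {K : Type} [Field K] [Valued K ℤᵐ⁰] {ρ Θ : K →+* K} {α ϖE h : K} {dρ t : ℕ}
variable {K' : Type*} [Field K'] [Valued K' ℤᵐ⁰] {σ' : K' →+* K'} {π' : K'} {d' : ℕ}

/-! ## §1 Two frame facts -/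

/-- Every unit has norm depth `|N(ω) − ρN(ω)| ≤ exp(−2d′)` (`N(ω) = ωΘω` is a `Θ`-fixed unit; ★ `v_twist_norm_sub_one_le`). [cite: Serre1979, Ch. IV §1 Prop. 3–4] -/
theorem v_norm_sub_map_le_of_unit (hΘΘ : ∀ x, Θ (Θ x) = x) (hvΘ : ∀ x, Valued.v (Θ x) = Valued.v x)
    (hσ' : ∀ x, σ' (σ' x) = x) (hfix' : ∀ x : K', σ' x = x → x ≠ 0 → ∃ n : ℤ, Valued.v x = exp (2 * n))
    (hπ' : Valued.v π' = exp (-1 : ℤ)) (hdd' : Valued.v (π' - σ' π') = Valued.v π' ^ d')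
    (jK : K' →+* K) (hjle : ∀ x y : K', Valued.v (jK x) ≤ Valued.v (jK y) ↔ Valued.v x ≤ Valued.v y)
    (hjfix : ∀ z : K, Θ z = z → ∃ x, jK x = z) (hjσ : ∀ x, jK (σ' x) = ρ (jK x)) (hjπ : Valued.v (jK π') = exp (-2 : ℤ))
    {ω : K} (hω : Valued.v ω = 1) : Valued.v (ω * Θ ω - ρ (ω * Θ ω)) ≤ exp (-(2 * (d' : ℤ))) := by
  have hN1 : Valued.v (ω * Θ ω) = 1 := by rw [map_mul, hvΘ, hω, mul_one]
  have hN0 : ω * Θ ω ≠ 0 := fun h0 => by rw [h0, map_zero] at hN1; exact zero_ne_one hN1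
  have h1 : ω * Θ ω - ρ (ω * Θ ω) = -((ρ (ω * Θ ω) / (ω * Θ ω) - 1) * (ω * Θ ω)) := by
    rw [div_sub_one hN0, div_mul_cancel₀ _ hN0]; ring
  rw [h1, Valuation.map_neg, Valuation.map_mul, hN1, mul_one]
  exact v_twist_norm_sub_one_le hΘΘ hvΘ hσ' hfix' hπ' hdd' jK hjle hjfix hjσ hjπ hω

omit [Valued K ℤᵐ⁰] in
/-- The class values `1 + η·t(ω)` (`η = (ρh∕h)·t(α^{k₀})`, `Θh = h`) are `Θ`-fixed. [cite: Jacobowitz1962, §4] -/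
theorem theta_one_add_classMult_mul_twist (hΘΘ : ∀ x, Θ (Θ x) = x) (hΘρ : ∀ x, Θ (ρ x) = ρ (Θ x)) (hΘh : Θ h = h) (k₀ : ℤ) (ω : K) :
    Θ (1 + ρ h / h * (ρ (α ^ k₀ * Θ (α ^ k₀)) / (α ^ k₀ * Θ (α ^ k₀))) * (ρ (ω * Θ ω) / (ω * Θ ω))) =
      1 + ρ h / h * (ρ (α ^ k₀ * Θ (α ^ k₀)) / (α ^ k₀ * Θ (α ^ k₀))) * (ρ (ω * Θ ω) / (ω * Θ ω)) := by
  simp only [map_add, map_one, map_mul, map_div₀, hΘρ, hΘh, hΘΘ]; ring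

/-! ## §2 Class-agnostic rows -/

/-- **`a = 0`, SHALLOW (`k ≤ −1`, i.e. `2j + d_ρ + 2 ≤ 2d′`)**: `#levelSet(j,0) = q^j` — the class is met by `ω = 1` (shallow letter `|1 + η| ≤ exp(−(2d′−2))`) and the norm-depth
subgroup at `exp(−(2j + d_ρ)) ≥ exp(−2d′)` is all of `U_M`. [cite: Flicker1998UnitaryFL, Prop. 7 p. 84] [cite: Serre1979, Ch. IV §1 Prop. 3–4] -/
theorem ncard_levelSet_zero_eq_pow_of_shallow [IsDiscreteValuationRing 𝒪[K]] [Finite 𝓀[K]]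
    (hD : IsRamifiedQuadraticDatum ρ α dρ t) (hΘΘ : ∀ x, Θ (Θ x) = x) (hvΘ : ∀ x, Valued.v (Θ x) = Valued.v x)
    (hϖE : Valued.v ϖE = exp (-2 : ℤ)) (hρϖ : ρ ϖE = ϖE) {q : ℕ} (hq : Nat.card 𝓀[K] = q)
    (hσ' : ∀ x, σ' (σ' x) = x) (hfix' : ∀ x : K', σ' x = x → x ≠ 0 → ∃ n : ℤ, Valued.v x = exp (2 * n))
    (hπ' : Valued.v π' = exp (-1 : ℤ)) (hdd' : Valued.v (π' - σ' π') = Valued.v π' ^ d')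
    (jK : K' →+* K) (hjle : ∀ x y : K', Valued.v (jK x) ≤ Valued.v (jK y) ↔ Valued.v x ≤ Valued.v y)
    (hjfix : ∀ z : K, Θ z = z → ∃ x, jK x = z) (hjσ : ∀ x, jK (σ' x) = ρ (jK x)) (hjπ : Valued.v (jK π') = exp (-2 : ℤ))
    (hh : h ≠ 0) {vh : ℤ} (hvh : Valued.v h = exp (-vh)) (j : ℕ) {k₀ : ℤ} (hk₀ : vh + dρ + 2 * k₀ + 2 * j = 0)
    (hle1 : Valued.v (1 + ρ h / h * (ρ (α ^ k₀ * Θ (α ^ k₀)) / (α ^ k₀ * Θ (α ^ k₀)))) ≤ exp (-(2 * (d' : ℤ) - 2)))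
    (hsh : 2 * (j : ℤ) + dρ + 2 ≤ 2 * d') :
    (levelSet ρ Θ α ϖE h j 0).ncard = q ^ j := by
  obtain ⟨hρρ, hvρ, hα, hfix, -, -, -⟩ := id hD
  have hρα := map_ne_self_of_datum hD
  have hdρ := v_sub_map_eq_exp_of_datum hD
  obtain ⟨U, hU⟩ := Literature.NumberTheory.LocalFields.WildQuadraticDatum.exists_subgroup_v_eq_one (K := K)
  obtain ⟨H, hH⟩ := exists_subgroup_orderUnits (ρ := ρ) (α := α) hvρ (ϖE ^ j)
  obtain ⟨B, hB⟩ := exists_subgroup_normDepth (Θ := Θ) hvρ hvΘ (exp (-(2 * (j : ℤ) + dρ)))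
  have hBU : B = U := by
    ext ω; rw [hB, hU]
    exact ⟨fun h1 => h1.1, fun h1 => ⟨h1, (v_norm_sub_map_le_of_unit hΘΘ hvΘ hσ' hfix' hπ' hdd' jK hjle hjfix hjσ hjπ h1).trans
      (by rw [exp_le_exp]; omega)⟩⟩
  have hcnt : (levelSet ρ Θ α ϖE h j 0).ncard = H.relIndex B :=
    ncard_levelSetR_zero_eq_relIndex_of_le hρρ hvρ hvΘ hfix hρα hα hdρ hϖE hρϖ hh hvh j hk₀ (ω₁ := 1) (by rw [Units.val_one, Valuation.map_one])
      (by rw [Units.val_one, map_one, mul_one, map_one, div_one, mul_one]; exact hle1.trans (by rw [exp_le_exp]; omega)) H B hH hB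
  rw [hcnt, hBU, relIndex_orderUnits_eq_of_isRamifiedQuadraticDatum hD hϖE hq j U H hU hH]

/-- **`a ≥ 1`, SHALLOW (`k ≤ −2`, i.e. `2j + d_ρ + 3 ≤ 2a + 2d′`)**: `#levelSet(j,a) = 0` — the class is met one step below the level by `ω = 1`, and both norm-depth subgroups are
all of `U_M`, so `[B : H] − [B′ : H] = 0`. [cite: Flicker1998UnitaryFL, Prop. 7 p. 84] [cite: Serre1979, Ch. IV §1 Prop. 3–4] -/
theorem ncard_levelSet_pos_eq_zero_of_shallow [IsDiscreteValuationRing 𝒪[K]] [Finite 𝓀[K]]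
    (hD : IsRamifiedQuadraticDatum ρ α dρ t) (hΘΘ : ∀ x, Θ (Θ x) = x) (hΘρ : ∀ x, Θ (ρ x) = ρ (Θ x)) (hvΘ : ∀ x, Valued.v (Θ x) = Valued.v x)
    (hϖE : Valued.v ϖE = exp (-2 : ℤ)) (hρϖ : ρ ϖE = ϖE) {q : ℕ} (hq : Nat.card 𝓀[K] = q)
    (hσ' : ∀ x, σ' (σ' x) = x) (hfix' : ∀ x : K', σ' x = x → x ≠ 0 → ∃ n : ℤ, Valued.v x = exp (2 * n))
    (hπ' : Valued.v π' = exp (-1 : ℤ)) (hdd' : Valued.v (π' - σ' π') = Valued.v π' ^ d')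
    (jK : K' →+* K) (hjle : ∀ x y : K', Valued.v (jK x) ≤ Valued.v (jK y) ↔ Valued.v x ≤ Valued.v y)
    (hjfix : ∀ z : K, Θ z = z → ∃ x, jK x = z) (hjσ : ∀ x, jK (σ' x) = ρ (jK x)) (hjπ : Valued.v (jK π') = exp (-2 : ℤ))
    (hh : h ≠ 0) {vh : ℤ} (hvh : Valued.v h = exp (-vh)) (j : ℕ) {a : ℕ} (ha : 1 ≤ a) {k₀ : ℤ} (hk₀ : vh + dρ + 2 * k₀ + 2 * j = 2 * a)
    (hle1 : Valued.v (1 + ρ h / h * (ρ (α ^ k₀ * Θ (α ^ k₀)) / (α ^ k₀ * Θ (α ^ k₀)))) ≤ exp (-(2 * (d' : ℤ) - 2)))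
    (hsh : 2 * (j : ℤ) + dρ + 3 ≤ 2 * a + 2 * d') :
    (levelSet ρ Θ α ϖE h j a).ncard = 0 := by
  obtain ⟨hρρ, hvρ, hα, hfix, -, -, -⟩ := id hD
  have hρα := map_ne_self_of_datum hD
  have hdρ := v_sub_map_eq_exp_of_datum hD
  obtain ⟨U, hU⟩ := Literature.NumberTheory.LocalFields.WildQuadraticDatum.exists_subgroup_v_eq_one (K := K)
  obtain ⟨H, hH⟩ := exists_subgroup_orderUnits (ρ := ρ) (α := α) hvρ (ϖE ^ j)
  obtain ⟨B, hB⟩ := exists_subgroup_normDepth (Θ := Θ) hvρ hvΘ (exp (2 * (a : ℤ) - 2 * j - dρ))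
  obtain ⟨B', hB'⟩ := exists_subgroup_normDepth (Θ := Θ) hvρ hvΘ (exp (2 * (a : ℤ) - 2 * j - dρ - 1))
  have hdepth := fun {ω : K} (h1 : Valued.v ω = 1) => v_norm_sub_map_le_of_unit hΘΘ hvΘ hσ' hfix' hπ' hdd' jK hjle hjfix hjσ hjπ h1
  have hBU : B = U := by
    ext ω; rw [hB, hU]
    exact ⟨fun h1 => h1.1, fun h1 => ⟨h1, (hdepth h1).trans (by rw [exp_le_exp]; omega)⟩⟩
  have hB'U : B' = U := by
    ext ω; rw [hB', hU]
    exact ⟨fun h1 => h1.1, fun h1 => ⟨h1, (hdepth h1).trans (by rw [exp_le_exp]; omega)⟩⟩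
  have hHB' : H ≤ B' := orderUnits_le_normDepth hvρ hΘρ hvΘ (by rw [v_conductorR (ρ := ρ) hdρ hϖE j, exp_le_exp]; omega) hH hB'
  have hHU : H.relIndex U = q ^ j := relIndex_orderUnits_eq_of_isRamifiedQuadraticDatum hD hϖE hq j U H hU hH
  have hHB0 : H.relIndex B ≠ 0 := by rw [hBU, hHU]; exact pow_ne_zero _ (card_residueField_ne_zero hq)
  have hcnt : (levelSet ρ Θ α ϖE h j a).ncard = H.relIndex B - H.relIndex B' :=
    ncard_levelSetR_eq_relIndex_sub_of_le hρρ hvρ hvΘ hfix hρα hα hdρ hϖE hρϖ hh hvh j ha hk₀ (ω₁ := 1) (by rw [Units.val_one, Valuation.map_one])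
      (by rw [Units.val_one, map_one, mul_one, map_one, div_one, mul_one]; exact hle1.trans (by rw [exp_le_exp]; omega)) H B B' hH hB hB' hHB'
      (finite_image_mk_smul_of_relIndex_ne_zero H B 1 hHB0)
  rw [hcnt, hBU, hB'U, Nat.sub_self]

/-- **`a ≥ 1`, THE `k = −1` LINE FOR A CLASS NOT MET AT K♮-DEPTH `d′`** (`2a + 2d′ = 2j + d_ρ + 2`; e.g. the odd class): the class is met at the level by `ω = 1` (shallow letter)
and by hypothesis NOT one step below (odd rounding on the `Θ`-fixed class values, `Θh = h`), so the level carries all of `G_j`: `#levelSet(j,a) = [U_M : 𝒪_jˣ] = q^j`.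
[cite: Flicker1998UnitaryFL, p. 84] [cite: Serre1979, Ch. V §3 Cor. 3] -/
theorem ncard_levelSet_pos_eq_pow_of_notMet [IsDiscreteValuationRing 𝒪[K]] [Finite 𝓀[K]]
    (hD : IsRamifiedQuadraticDatum ρ α dρ t) (hΘρ : ∀ x, Θ (ρ x) = ρ (Θ x)) (hvΘ : ∀ x, Valued.v (Θ x) = Valued.v x)
    (hϖE : Valued.v ϖE = exp (-2 : ℤ)) (hρϖ : ρ ϖE = ϖE) {q : ℕ} (hq : Nat.card 𝓀[K] = q)
    (hσ' : ∀ x, σ' (σ' x) = x) (hfix' : ∀ x : K', σ' x = x → x ≠ 0 → ∃ n : ℤ, Valued.v x = exp (2 * n))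
    (hπ' : Valued.v π' = exp (-1 : ℤ)) (hdd' : Valued.v (π' - σ' π') = Valued.v π' ^ d')
    (jK : K' →+* K) (hjle : ∀ x y : K', Valued.v (jK x) ≤ Valued.v (jK y) ↔ Valued.v x ≤ Valued.v y)
    (hjfix : ∀ z : K, Θ z = z → ∃ x, jK x = z) (hjσ : ∀ x, jK (σ' x) = ρ (jK x)) (hjπ : Valued.v (jK π') = exp (-2 : ℤ))
    {ϖ : K} {dΘ tΘ : ℕ} (hDΘ : IsRamifiedQuadraticDatum Θ ϖ dΘ tΘ) (hΘh : Θ h = h)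
    (hh : h ≠ 0) {vh : ℤ} (hvh : Valued.v h = exp (-vh)) (j : ℕ) {a : ℕ} (ha : 1 ≤ a) {k₀ : ℤ} (hk₀ : vh + dρ + 2 * k₀ + 2 * j = 2 * a)
    (hle1 : Valued.v (1 + ρ h / h * (ρ (α ^ k₀ * Θ (α ^ k₀)) / (α ^ k₀ * Θ (α ^ k₀)))) ≤ exp (-(2 * (d' : ℤ) - 2)))
    (hnone0 : ∀ ω : Kˣ, Valued.v (ω : K) = 1 →
      ¬ Valued.v (1 + ρ h / h * (ρ (α ^ k₀ * Θ (α ^ k₀)) / (α ^ k₀ * Θ (α ^ k₀))) * (ρ ((ω : K) * Θ ω) / ((ω : K) * Θ ω))) ≤ exp (-(2 * (d' : ℤ))))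
    (hline : 2 * (a : ℤ) + 2 * d' = 2 * j + dρ + 2) :
    (levelSet ρ Θ α ϖE h j a).ncard = q ^ j := by
  obtain ⟨hρρ, hvρ, hα, hfix, -, -, -⟩ := id hD
  have hΘΘ := hDΘ.1
  have hρα := map_ne_self_of_datum hD
  have hdρ := v_sub_map_eq_exp_of_datum hD
  obtain ⟨U, hU⟩ := Literature.NumberTheory.LocalFields.WildQuadraticDatum.exists_subgroup_v_eq_one (K := K)
  obtain ⟨H, hH⟩ := exists_subgroup_orderUnits (ρ := ρ) (α := α) hvρ (ϖE ^ j)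
  obtain ⟨B, hB⟩ := exists_subgroup_normDepth (Θ := Θ) hvρ hvΘ (exp (2 * (a : ℤ) - 2 * j - dρ))
  have hBU : B = U := by
    ext ω; rw [hB, hU]
    exact ⟨fun h1 => h1.1, fun h1 => ⟨h1, (v_norm_sub_map_le_of_unit hΘΘ hvΘ hσ' hfix' hπ' hdd' jK hjle hjfix hjσ hjπ h1).trans
      (by rw [exp_le_exp]; omega)⟩⟩
  have hnone : ∀ ω : Kˣ, Valued.v (ω : K) = 1 →
      ¬ Valued.v (1 + ρ h / h * (ρ (α ^ k₀ * Θ (α ^ k₀)) / (α ^ k₀ * Θ (α ^ k₀))) * (ρ ((ω : K) * Θ ω) / ((ω : K) * Θ ω))) ≤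
        exp (2 * (a : ℤ) - 2 * j - dρ - 1) := fun ω hω hle => by
    refine hnone0 ω hω ?_
    have hodd := (v_le_exp_odd_iff_of_theta_fixed hDΘ (theta_one_add_classMult_mul_twist hΘΘ hΘρ hΘh k₀ (ω : K)) (-(d' : ℤ) + 1)).1
      (hle.trans (by rw [exp_le_exp]; omega))
    exact hodd.trans (by rw [exp_le_exp]; omega)
  have hcnt : (levelSet ρ Θ α ϖE h j a).ncard = H.relIndex B :=
    ncard_levelSetR_eq_relIndex_of_le_of_forall_not hρρ hvρ hvΘ hfix hρα hα hdρ hϖE hρϖ hh hvh j ha hk₀ (ω₁ := 1) (by rw [Units.val_one, Valuation.map_one])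
      (by rw [Units.val_one, map_one, mul_one, map_one, div_one, mul_one]; exact hle1.trans (by rw [exp_le_exp]; omega)) hnone H B hH hB
  rw [hcnt, hBU, relIndex_orderUnits_eq_of_isRamifiedQuadraticDatum hD hϖE hq j U H hU hH]

/-- **`a ≥ 1`, CLASS NOT MET AT THE LEVEL**: `#levelSet(j,a) = 0` (★ p857782, subgroups built in). [cite: Flicker1998UnitaryFL, p. 84] -/
theorem ncard_levelSet_pos_eq_zero_of_notMet (hD : IsRamifiedQuadraticDatum ρ α dρ t) (hvΘ : ∀ x, Valued.v (Θ x) = Valued.v x)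
    (hϖE : Valued.v ϖE = exp (-2 : ℤ)) (hρϖ : ρ ϖE = ϖE) (hh : h ≠ 0) {vh : ℤ} (hvh : Valued.v h = exp (-vh))
    (j : ℕ) {a : ℕ} (ha : 1 ≤ a) {k₀ : ℤ} (hk₀ : vh + dρ + 2 * k₀ + 2 * j = 2 * a)
    (hnone : ∀ ω : Kˣ, Valued.v (ω : K) = 1 →
      ¬ Valued.v (1 + ρ h / h * (ρ (α ^ k₀ * Θ (α ^ k₀)) / (α ^ k₀ * Θ (α ^ k₀))) * (ρ ((ω : K) * Θ ω) / ((ω : K) * Θ ω))) ≤ exp (2 * (a : ℤ) - 2 * j - dρ)) :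
    (levelSet ρ Θ α ϖE h j a).ncard = 0 := by
  obtain ⟨hρρ, hvρ, hα, hfix, -, -, -⟩ := id hD
  obtain ⟨H, hH⟩ := exists_subgroup_orderUnits (ρ := ρ) (α := α) hvρ (ϖE ^ j)
  exact ncard_levelSetR_eq_zero_of_forall_not hρρ hvρ hvΘ hfix (map_ne_self_of_datum hD) hα (v_sub_map_eq_exp_of_datum hD) hϖE hρϖ hh hvh j ha hk₀ hnone H hH

/-- **`a = 0`, CLASS NOT MET AT THE LEVEL**: `#levelSet(j,0) = 0` (★ p857782). [cite: Flicker1998UnitaryFL, p. 84] -/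
theorem ncard_levelSet_zero_eq_zero_of_notMet (hD : IsRamifiedQuadraticDatum ρ α dρ t) (hvΘ : ∀ x, Valued.v (Θ x) = Valued.v x)
    (hϖE : Valued.v ϖE = exp (-2 : ℤ)) (hρϖ : ρ ϖE = ϖE) (hh : h ≠ 0) {vh : ℤ} (hvh : Valued.v h = exp (-vh))
    (j : ℕ) {k₀ : ℤ} (hk₀ : vh + dρ + 2 * k₀ + 2 * j = 0)
    (hnone : ∀ ω : Kˣ, Valued.v (ω : K) = 1 →
      ¬ Valued.v (1 + ρ h / h * (ρ (α ^ k₀ * Θ (α ^ k₀)) / (α ^ k₀ * Θ (α ^ k₀))) * (ρ ((ω : K) * Θ ω) / ((ω : K) * Θ ω))) ≤ exp (-(2 * (j : ℤ) + dρ))) :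
    (levelSet ρ Θ α ϖE h j 0).ncard = 0 := by
  obtain ⟨hρρ, hvρ, hα, hfix, -, -, -⟩ := id hD
  obtain ⟨H, hH⟩ := exists_subgroup_orderUnits (ρ := ρ) (α := α) hvρ (ϖE ^ j)
  exact ncard_levelSetR_zero_eq_zero_of_forall_not hρρ hvρ hvΘ hfix (map_ne_self_of_datum hD) hα (v_sub_map_eq_exp_of_datum hD) hϖE hρϖ hh hvh j hk₀ hnone H hH

/-! ## §3 The anchored (non-norm) class is met exactly below the threshold -/

/-- **THE ANCHORED CLASS AT K♮-LEVEL `k`**: if `η·t(ω₀)·ψ(n₀) = −1` for a unit `ω₀` and the `Θ`-fixed unit non-norm `n₀`, then `(∃ ω₁ ∈ U_M, |1 + η·t(ω₁)| ≤ |jK π′^{d′+k}|) ⟺ k + 2 ≤ dΘ`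
(`1 + η·t(ω₁) = 1 − t(ω₁)∕(t(ω₀)ψ(n₀))` has the value of `ψ(n₀)·t(ω₀ω₁⁻¹) − 1`; ★ `anchored_twist_near_iff_lt_threshold`). [cite: Serre1979, Ch. V §3 Cor. 3] [cite: Jacobowitz1962, §4] -/
theorem met_iff_le_threshold_of_anchor [CompleteSpace K] [Finite 𝓀[K]] (hvΘ : ∀ x, Valued.v (Θ x) = Valued.v x) (hvρ : ∀ x, Valued.v (ρ x) = Valued.v x)
    (hσ' : ∀ x, σ' (σ' x) = x) (hvσ' : ∀ x, Valued.v (σ' x) = Valued.v x) (hfix' : ∀ x : K', σ' x = x → x ≠ 0 → ∃ n : ℤ, Valued.v x = exp (2 * n))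
    (hπ' : Valued.v π' = exp (-1 : ℤ)) (hdd' : Valued.v (π' - σ' π') = Valued.v π' ^ d')
    (jK : K' →+* K) (hjle : ∀ x y : K', Valued.v (jK x) ≤ Valued.v (jK y) ↔ Valued.v x ≤ Valued.v y) (hjΘ : ∀ x, Θ (jK x) = jK x)
    (hjfix : ∀ z : K, Θ z = z → ∃ x, jK x = z) (hjσ : ∀ x, jK (σ' x) = ρ (jK x)) (hjπ : Valued.v (jK π') = exp (-2 : ℤ))
    {ϖ : K} {dΘ tΘ : ℕ} (hDΘ : IsRamifiedQuadraticDatum Θ ϖ dΘ tΘ)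
    (hFN : ∀ f : K, ρ f = f → Θ f = f → Valued.v f = 1 → ∃ x : K, x * Θ x = f)
    {n₀ : K} (hΘn₀ : Θ n₀ = n₀) (hn₀1 : Valued.v n₀ = 1) (hn₀N : ¬ ∃ z : K, z * Θ z = n₀)
    {η : K} {ω₀ : Kˣ} (hω₀ : Valued.v (ω₀ : K) = 1) (hanch : η * (ρ ((ω₀ : K) * Θ ω₀) / ((ω₀ : K) * Θ ω₀)) * (ρ n₀ / n₀) = -1) (k : ℕ) :
    (∃ ω₁ : Kˣ, Valued.v (ω₁ : K) = 1 ∧ Valued.v (1 + η * (ρ ((ω₁ : K) * Θ ω₁) / ((ω₁ : K) * Θ ω₁))) ≤ Valued.v (jK π' ^ (d' + k))) ↔ k + 2 ≤ dΘ := by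
  rw [← anchored_twist_near_iff_lt_threshold hvΘ hσ' hvσ' hfix' hπ' hdd' jK hjle hjΘ hjfix hjσ hjπ hDΘ hFN hΘn₀ hn₀1 hn₀N k]
  have hn₀0 : n₀ ≠ 0 := fun h0 => by rw [h0, map_zero] at hn₀1; exact zero_ne_one hn₀1
  have hψ1 : Valued.v (ρ n₀ / n₀) = 1 := by rw [map_div₀, hvρ, div_self ((Valuation.ne_zero_iff _).2 hn₀0)]
  have hψ0 : ρ n₀ / n₀ ≠ 0 := fun h0 => by rw [h0, map_zero] at hψ1; exact zero_ne_one hψ1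
  have hω₀0 : (ω₀ : K) ≠ 0 := ω₀.ne_zero
  have ht₀1 : Valued.v (ρ ((ω₀ : K) * Θ ω₀) / ((ω₀ : K) * Θ ω₀)) = 1 := v_normTwist_eq_one hvρ hω₀0
  have ht₀0 : ρ ((ω₀ : K) * Θ ω₀) / ((ω₀ : K) * Θ ω₀) ≠ 0 := fun h0 => by rw [h0, map_zero] at ht₀1; exact zero_ne_one ht₀1
  have hη : η = -1 / (ρ ((ω₀ : K) * Θ ω₀) / ((ω₀ : K) * Θ ω₀) * (ρ n₀ / n₀)) := by
    rw [eq_div_iff (mul_ne_zero ht₀0 hψ0), ← mul_assoc]; exact hanch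
  -- `|1 + η t(ω₁)| = |ψ·t(ω₀ω₁⁻¹) − 1|`
  have key : ∀ ω₁ : K, ω₁ ≠ 0 → Valued.v (1 + η * (ρ (ω₁ * Θ ω₁) / (ω₁ * Θ ω₁))) =
      Valued.v (ρ n₀ / n₀ * (ρ ((ω₀ : K) * ω₁⁻¹ * Θ ((ω₀ : K) * ω₁⁻¹)) / ((ω₀ : K) * ω₁⁻¹ * Θ ((ω₀ : K) * ω₁⁻¹))) - 1) := fun ω₁ hω₁0 => by
    have ht₁ : Valued.v (ρ (ω₁ * Θ ω₁) / (ω₁ * Θ ω₁)) = 1 := v_normTwist_eq_one hvρ hω₁0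
    have ht₁0 : ρ (ω₁ * Θ ω₁) / (ω₁ * Θ ω₁) ≠ 0 := fun h0 => by rw [h0, map_zero] at ht₁; exact zero_ne_one ht₁
    have hT1 : Valued.v ((ρ (ω₁ * Θ ω₁) / (ω₁ * Θ ω₁)) / (ρ ((ω₀ : K) * Θ ω₀) / ((ω₀ : K) * Θ ω₀) * (ρ n₀ / n₀))) = 1 := by
      rw [map_div₀, Valuation.map_mul, ht₁, ht₀1, hψ1, one_mul, div_one]
    have halg : ∀ {t₀ t₁ ψ : K}, t₀ ≠ 0 → t₁ ≠ 0 → ψ ≠ 0 → 1 + -1 / (t₀ * ψ) * t₁ = (ψ * (t₀ / t₁) - 1) * (t₁ / (t₀ * ψ)) := by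
      intro t₀ t₁ ψ h0 h1 h2; field_simp; ring
    rw [normTwist_mul_inv hω₀0 hω₁0, hη, halg ht₀0 ht₁0 hψ0, Valuation.map_mul, hT1, mul_one]
  constructor
  · rintro ⟨ω₁, hω₁, hle⟩
    have hω₁0 : (ω₁ : K) ≠ 0 := ω₁.ne_zero
    refine ⟨(ω₀ : K) * (ω₁ : K)⁻¹, by rw [map_mul, map_inv₀, hω₀, hω₁, inv_one, mul_one], ?_⟩
    rw [← key _ hω₁0]; exact hle
  · rintro ⟨ω, hω, hle⟩
    have hω0 : ω ≠ 0 := fun h0 => by rw [h0, map_zero] at hω; exact zero_ne_one hω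
    have hne : (ω₀ : K) * ω⁻¹ ≠ 0 := mul_ne_zero hω₀0 (inv_ne_zero hω0)
    refine ⟨Units.mk0 _ hne, by rw [Units.val_mk0, map_mul, map_inv₀, hω₀, hω, inv_one, mul_one], ?_⟩
    rw [Units.val_mk0, key _ hne, show (ω₀ : K) * ((ω₀ : K) * ω⁻¹)⁻¹ = ω by field_simp]
    exact hle

end Summit.HodgeConjecture.HodgeConjecture.Cruxes.H413.F0P3cDyRamToricLevelCensusRamM

end
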